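import Literature.Barriers.NavierStokesRegularity.SchefferSwitchedStrips
import HarnessLib

/-!
# Scheffer's switched field: global integrability, measurability and the energy bound

Barrier-catalogue support file for `NavierStokesRegularity` (D-0021), part of the discharge of
`IsNSIBlock.switching` / `NSISwitching` (Scheffer 1985, Lemma 2.3; Ożański 2017, §2). From the
strip identities of `SchefferSwitchedStrips.lean` and the geometric series `Σⱼ τ^{mj} < ∞`
(`m ≥ 1`) we obtain, for the glued field `𝔲 = Scheffer.glue T τ z u` of a classical NSI block:

* `𝔲, D𝔲 ∈ L¹(ℝ × ℝ³)`, `|𝔲|², |𝔲|³, |p̃[𝔲]||𝔲|, |D𝔲|² ∈ L¹` (Ożański 2017, §2 p. 7: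
  "global-in-time integrability of all the terms appearing under the space-time integrals";
  Scheffer 1985, (2.34): `|∇u|², |u|³, |u||p|` integrable), packaged as the hypotheses of the
  gluing principle `isWeakNSISolution_of_piecewise` on `(0,∞) × ℝ³`;
* the a.e.-strong measurability of the piecewise-continuous fields `𝔲`, `D𝔲`, `p̃[𝔲]`;
* the energy bound `sup_{s>0} ∫|𝔲(s)|² < ∞` (Ożański 2017, §2: `‖𝔲(t)‖ ≤ τ^{j/2} sup‖u‖`).

## References

* W. S. Ożański, arXiv:1709.00602 (2017), §2 p. 7. [`Ozanski2017NSISingular`]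
* V. Scheffer, Comm. Math. Phys. 101 (1985), proof of Lemma 2.3, (2.34). [`Scheffer1985`]
-/

noncomputable section

open MeasureTheory Set Function Filter Topology TopologicalSpace Metric Module
open scoped ENNReal InnerProductSpace RealInnerProductSpace ContDiff Laplacian

namespace Literature.Barriers.NavierStokesRegularity

namespace IsNSIBlock

open Scheffer Literature.Analysis.FluidPDE

variable {T ν₀ τ : ℝ} {z : EuclideanSpace ℝ (Fin 3)} {G : Set (EuclideanSpace ℝ (Fin 3))}
  {u : ℝ → EuclideanSpace ℝ (Fin 3) → EuclideanSpace ℝ (Fin 3)}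

/-! ### Sums over the strips -/

/-- A geometric series with ratio `θ ∈ [0,1)` is finite in `ℝ≥0∞`. [folklore] -/
theorem tsum_ofReal_pow_lt_top {θ : ℝ} (h0 : 0 ≤ θ) (h1 : θ < 1) :
    ∑' j : ℕ, ENNReal.ofReal (θ ^ j) < ⊤ := by
  simp_rw [ENNReal.ofReal_pow h0]
  rw [ENNReal.tsum_geometric, ENNReal.inv_lt_top, tsub_pos_iff_lt]
  exact ENNReal.ofReal_lt_one.2 h1

/-- **Space–time integrals of the glued field are sums over the strips**: for an integrand
vanishing off `[0, T₀) × ℝ³`, `∫⁻ H = Σⱼ ∫⁻_{[t_j,t_{j+1}) × ℝ³} H`. [cite: Ozanski2017NSISingular, §2 p. 7] -/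
theorem lintegral_eq_tsum_strip (h : IsNSIBlock T ν₀ τ z G u) {H : ℝ × EuclideanSpace ℝ (Fin 3) → ℝ≥0∞}
    (hH0 : ∀ q : ℝ × EuclideanSpace ℝ (Fin 3), q.1 ∉ Ico 0 (blowupTime T τ) → H q = 0) :
    ∫⁻ q, H q = ∑' j : ℕ, ∫⁻ q in Ico (switchTime T τ j) (switchTime T τ (j + 1)) ×ˢ
      (univ : Set (EuclideanSpace ℝ (Fin 3))), H q := by
  have hU := iUnion_strip_eq (E := EuclideanSpace ℝ (Fin 3)) (strictMono_switchTime h.T_pos h.τ_pos)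
    (tendsto_switchTime h.τ_pos.le h.τ_lt_one)
  rw [switchTime_zero] at hU
  rw [← lintegral_iUnion (measurableSet_strip (E := EuclideanSpace ℝ (Fin 3)))
    (pairwise_disjoint_strip (strictMono_switchTime h.T_pos h.τ_pos)), hU]
  refine (setLIntegral_eq_of_support_subset fun q hq => ?_).symm
  by_contra hq'
  exact hq (hH0 q fun h' => hq' ⟨h', mem_univ _⟩)

/-- Off `[0, T₀)` the glued field vanishes. [folklore] -/
theorem glue_eq_zero_of_notMem (h : IsNSIBlock T ν₀ τ z G u) {s : ℝ} (hs : s ∉ Ico 0 (blowupTime T τ)) :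
    glue T τ z u s = 0 := by
  by_cases h0 : 0 ≤ s
  · exact glue_eq_zero_of_le h.T_pos h.τ_pos h.τ_lt_one z u (not_lt.1 fun h' => hs ⟨h0, h'⟩)
  · exact glue_eq_zero_of_neg h.T_pos h.τ_pos z u (not_le.1 h0)

/-- **`|𝔲|ⁿ ∈ L¹(ℝ × ℝ³)` for `1 ≤ n ≤ 4`** (`Σⱼ τ^{(5-n)j} < ∞`). [cite: Scheffer1985, proof of Lemma 2.3 (2.34)] -/
theorem lintegral_enorm_glue_pow_lt_top (h : IsNSIBlock T ν₀ τ z G u) {n : ℕ} (hn1 : 1 ≤ n) (hn : n ≤ 4) :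
    ∫⁻ q : ℝ × EuclideanSpace ℝ (Fin 3), ‖glue T τ z u q.1 q.2‖ₑ ^ n < ⊤ := by
  rw [h.lintegral_eq_tsum_strip fun q hq => by
    simp [h.glue_eq_zero_of_notMem hq, zero_pow (Nat.one_le_iff_ne_zero.1 hn1)]]
  simp_rw [h.setLIntegral_strip_enorm_glue_pow _ (hn.trans (by norm_num))]
  rw [ENNReal.tsum_mul_right]
  refine ENNReal.mul_lt_top ?_ (h.base_lt_top_norm_pow (Nat.one_le_iff_ne_zero.1 hn1))
  simp_rw [pow_mul]
  exact tsum_ofReal_pow_lt_top (pow_nonneg h.τ_pos.le _)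
    (pow_lt_one₀ h.τ_pos.le h.τ_lt_one (by omega))

/-- Off `[0, T₀)` the slice derivative of the glued field vanishes. [folklore] -/
theorem fderiv_glue_eq_zero_of_notMem (h : IsNSIBlock T ν₀ τ z G u) {s : ℝ}
    (hs : s ∉ Ico 0 (blowupTime T τ)) (x : EuclideanSpace ℝ (Fin 3)) :
    fderiv ℝ (glue T τ z u s) x = 0 := by
  rw [h.glue_eq_zero_of_notMem hs]
  exact fderiv_const_apply _

/-- **`D𝔲 ∈ L¹(ℝ × ℝ³)`** (`Σⱼ τ^{3j} < ∞`). [folklore] -/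
theorem lintegral_enorm_fderiv_glue_lt_top (h : IsNSIBlock T ν₀ τ z G u) :
    ∫⁻ q : ℝ × EuclideanSpace ℝ (Fin 3), ‖fderiv ℝ (glue T τ z u q.1) q.2‖ₑ < ⊤ := by
  rw [h.lintegral_eq_tsum_strip fun q hq => by
    rw [h.fderiv_glue_eq_zero_of_notMem hq, ← ofReal_norm, norm_zero, ENNReal.ofReal_zero]]
  simp_rw [h.setLIntegral_strip_enorm_fderiv_glue]
  rw [ENNReal.tsum_mul_right]
  refine ENNReal.mul_lt_top ?_ h.base_lt_top_fderiv
  simp_rw [pow_mul]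
  exact tsum_ofReal_pow_lt_top (pow_nonneg h.τ_pos.le _) (pow_lt_one₀ h.τ_pos.le h.τ_lt_one (by norm_num))

/-- **`|D𝔲|² ∈ L¹(ℝ × ℝ³)`**: `∫∫|∇𝔲|² = (Σⱼ τʲ) ∫₀ᵀ∫|∇u|² < ∞` (Ożański 2017, §2 p. 7).
[cite: Ozanski2017NSISingular, §2 p. 7] -/
theorem lintegral_frobeniusNormSq_glue_lt_top (h : IsNSIBlock T ν₀ τ z G u) :
    ∫⁻ q : ℝ × EuclideanSpace ℝ (Fin 3),
      ENNReal.ofReal (frobeniusNormSq (fderiv ℝ (glue T τ z u q.1) q.2)) < ⊤ := by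
  rw [h.lintegral_eq_tsum_strip fun q hq => by
    simp [h.fderiv_glue_eq_zero_of_notMem hq, frobeniusNormSq_zero]]
  simp_rw [h.setLIntegral_strip_frobeniusNormSq_glue]
  rw [ENNReal.tsum_mul_right]
  exact ENNReal.mul_lt_top (tsum_ofReal_pow_lt_top h.τ_pos.le h.τ_lt_one) h.base_lt_top_frobeniusNormSq

/-- **`|p̃[𝔲]||𝔲| ∈ L¹(ℝ × ℝ³)`** (`Σⱼ τ^{2j} < ∞`; Scheffer 1985, (1.6): "`|u||p|` integrable").
[cite: Scheffer1985, proof of Lemma 2.3 (2.34)] -/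
theorem lintegral_pressure_mul_norm_glue_lt_top (h : IsNSIBlock T ν₀ τ z G u) :
    ∫⁻ q : ℝ × EuclideanSpace ℝ (Fin 3),
      ‖normalisedPressure (glue T τ z u q.1) q.2 * ‖glue T τ z u q.1 q.2‖‖ₑ < ⊤ := by
  rw [h.lintegral_eq_tsum_strip fun q hq => by simp [h.glue_eq_zero_of_notMem hq]]
  simp_rw [h.setLIntegral_strip_pressure_mul_norm_glue]
  rw [ENNReal.tsum_mul_right]
  refine ENNReal.mul_lt_top ?_ h.base_lt_top_pressure_mul_norm
  simp_rw [pow_mul]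
  exact tsum_ofReal_pow_lt_top (pow_nonneg h.τ_pos.le _) (pow_lt_one₀ h.τ_pos.le h.τ_lt_one (by norm_num))

/-! ### Measurability of the piecewise-continuous fields -/

/-- **A field on `ℝ × ℝ³` vanishing off `[0,T₀) × ℝ³` and agreeing on each strip
`[t_j, t_{j+1}) × ℝ³` with a field continuous on the closed strip is a.e.-strongly measurable.**
[folklore] -/
theorem aestronglyMeasurable_of_strips (h : IsNSIBlock T ν₀ τ z G u) {X : Type*} [NormedAddCommGroup X]
    [NormedSpace ℝ X] {f : ℝ × EuclideanSpace ℝ (Fin 3) → X}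
    (hf0 : ∀ q : ℝ × EuclideanSpace ℝ (Fin 3), q.1 ∉ Ico 0 (blowupTime T τ) → f q = 0)
    (g : ℕ → ℝ × EuclideanSpace ℝ (Fin 3) → X)
    (hg : ∀ j, ContinuousOn (g j) (Icc (switchTime T τ j) (switchTime T τ (j + 1)) ×ˢ univ))
    (hfg : ∀ j (q : ℝ × EuclideanSpace ℝ (Fin 3)),
      q.1 ∈ Ico (switchTime T τ j) (switchTime T τ (j + 1)) → f q = g j q) :
    AEStronglyMeasurable f (volume : Measure (ℝ × EuclideanSpace ℝ (Fin 3))) := by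
  have hU := iUnion_strip_eq (E := EuclideanSpace ℝ (Fin 3)) (strictMono_switchTime h.T_pos h.τ_pos)
    (tendsto_switchTime h.τ_pos.le h.τ_lt_one)
  rw [switchTime_zero] at hU
  -- on the union of the strips
  have h1 : AEStronglyMeasurable f (volume.restrict
      (Ico 0 (blowupTime T τ) ×ˢ (univ : Set (EuclideanSpace ℝ (Fin 3))))) := by
    rw [← hU, aestronglyMeasurable_iUnion_iff]
    intro j
    have hgj : AEStronglyMeasurable (g j) (volume.restrict
        (Ico (switchTime T τ j) (switchTime T τ (j + 1)) ×ˢ (univ : Set (EuclideanSpace ℝ (Fin 3))))) :=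
      ((hg j).mono (prod_mono Ico_subset_Icc_self Subset.rfl)).aestronglyMeasurable
        (measurableSet_Ico.prod MeasurableSet.univ)
    refine hgj.congr ?_
    filter_upwards [ae_restrict_mem (measurableSet_Ico.prod MeasurableSet.univ)] with q hq
    exact (hfg j q (mem_prod.1 hq).1).symm
  -- on the complement the field vanishes
  have h2 : AEStronglyMeasurable f (volume.restrict
      (Ico 0 (blowupTime T τ) ×ˢ (univ : Set (EuclideanSpace ℝ (Fin 3))))ᶜ) := by
    refine (aestronglyMeasurable_const (b := (0 : X))).congr ?_
    filter_upwards [ae_restrict_mem (measurableSet_Ico.prod MeasurableSet.univ).compl] with q hq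
    exact (hf0 q fun h' => hq ⟨h', mem_univ _⟩).symm
  have h3 := (aestronglyMeasurable_union_iff (μ := (volume : Measure (ℝ × EuclideanSpace ℝ (Fin 3))))
    (s := Ico 0 (blowupTime T τ) ×ˢ (univ : Set (EuclideanSpace ℝ (Fin 3))))
    (t := (Ico 0 (blowupTime T τ) ×ˢ (univ : Set (EuclideanSpace ℝ (Fin 3))))ᶜ)).2 ⟨h1, h2⟩
  rwa [union_compl_self, Measure.restrict_univ] at h3

/-- `(s, x) ↦ u^{(j)}(s, x)` is continuous on the closed `j`-th strip. [folklore] -/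
theorem continuousOn_uncurry_piece (h : IsNSIBlock T ν₀ τ z G u) (j : ℕ) :
    ContinuousOn (uncurry (piece T τ z u j)) (Icc (switchTime T τ j) (switchTime T τ (j + 1)) ×ˢ univ) := by
  obtain ⟨η, hη, hsm⟩ := h.isSmoothSpaceTimeOn_piece j
  exact hsm.continuousOn.mono (prod_mono (Icc_switchTime_subset_preimage h.τ_pos hη j) Subset.rfl)

/-- `(s, x) ↦ D u^{(j)}(s)(x)` is continuous on the closed `j`-th strip. [folklore] -/
theorem continuousOn_fderiv_piece (h : IsNSIBlock T ν₀ τ z G u) (j : ℕ) :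
    ContinuousOn (fun q : ℝ × EuclideanSpace ℝ (Fin 3) => fderiv ℝ (piece T τ z u j q.1) q.2)
      (Icc (switchTime T τ j) (switchTime T τ (j + 1)) ×ˢ univ) := by
  obtain ⟨η, hη, hsm⟩ := h.isSmoothSpaceTimeOn_piece j
  have hopen : IsOpen ((fun r => -((τ⁻¹) ^ (2 * j) * switchTime T τ j) + (τ⁻¹) ^ (2 * j) * r) ⁻¹'
      Ioo (-η) (T + η)) := isOpen_Ioo.preimage (by fun_prop)
  have h1 := continuousOn_fderiv_slice_of_contDiffOn (hsm.of_le (by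
    change ((1 : ℕ∞) : WithTop ℕ∞) ≤ ((⊤ : ℕ∞) : WithTop ℕ∞); exact_mod_cast le_top)) hopen.uniqueDiffOn
  exact h1.mono (prod_mono (Icc_switchTime_subset_preimage h.τ_pos hη j) Subset.rfl)

/-- **`𝔲` is a.e.-strongly measurable on `ℝ × ℝ³`.** [folklore] -/
theorem aestronglyMeasurable_glue (h : IsNSIBlock T ν₀ τ z G u) :
    AEStronglyMeasurable (fun q : ℝ × EuclideanSpace ℝ (Fin 3) => glue T τ z u q.1 q.2)
      (volume : Measure (ℝ × EuclideanSpace ℝ (Fin 3))) :=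
  h.aestronglyMeasurable_of_strips (fun q hq => by rw [h.glue_eq_zero_of_notMem hq]; rfl)
    (fun j => uncurry (piece T τ z u j)) h.continuousOn_uncurry_piece
    fun j q hq => by rw [glue_eq_piece h.T_pos h.τ_pos z u hq]; rfl

/-- **`D𝔲` is a.e.-strongly measurable on `ℝ × ℝ³`.** [folklore] -/
theorem aestronglyMeasurable_fderiv_glue (h : IsNSIBlock T ν₀ τ z G u) :
    AEStronglyMeasurable (fun q : ℝ × EuclideanSpace ℝ (Fin 3) => fderiv ℝ (glue T τ z u q.1) q.2)
      (volume : Measure (ℝ × EuclideanSpace ℝ (Fin 3))) :=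
  h.aestronglyMeasurable_of_strips (fun q hq => h.fderiv_glue_eq_zero_of_notMem hq q.2)
    (fun j q => fderiv ℝ (piece T τ z u j q.1) q.2) h.continuousOn_fderiv_piece
    fun j q hq => by simp only [glue_eq_piece h.T_pos h.τ_pos z u hq]

/-- **`p̃[𝔲]` is a.e.-strongly measurable on `ℝ × ℝ³`.** [folklore] -/
theorem aestronglyMeasurable_pressure_glue (h : IsNSIBlock T ν₀ τ z G u) :
    AEStronglyMeasurable (fun q : ℝ × EuclideanSpace ℝ (Fin 3) => normalisedPressure (glue T τ z u q.1) q.2)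
      (volume : Measure (ℝ × EuclideanSpace ℝ (Fin 3))) :=
  h.aestronglyMeasurable_of_strips
    (fun q hq => by simp only [h.glue_eq_zero_of_notMem hq, normalisedPressure_zero, Pi.zero_apply])
    (fun j q => normalisedPressure (piece T τ z u j q.1) q.2) h.continuousOn_normalisedPressure_piece
    fun j q hq => by simp only [glue_eq_piece h.T_pos h.τ_pos z u hq]

/-! ### Packaging: integrability on `(0,∞) × ℝ³` -/

/-- **`𝔲 ∈ L¹((0,∞) × ℝ³)`.** [cite: Ozanski2017NSISingular, §2 p. 7] -/
theorem integrableOn_glue (h : IsNSIBlock T ν₀ τ z G u) :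
    IntegrableOn (uncurry (glue T τ z u))
      ((positiveTimes : Opens (ℝ × EuclideanSpace ℝ (Fin 3))) : Set (ℝ × EuclideanSpace ℝ (Fin 3))) volume := by
  rw [Function.uncurry_def]
  refine Integrable.integrableOn ⟨h.aestronglyMeasurable_glue, ?_⟩
  rw [hasFiniteIntegral_iff_enorm]
  have h1 := h.lintegral_enorm_glue_pow_lt_top le_rfl (by norm_num : 1 ≤ 4)
  simp only [pow_one] at h1
  exact h1

/-- **`D𝔲 ∈ L¹((0,∞) × ℝ³)`.** [folklore] -/
theorem integrableOn_fderiv_glue (h : IsNSIBlock T ν₀ τ z G u) :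
    IntegrableOn (uncurry fun s x => fderiv ℝ (glue T τ z u s) x)
      ((positiveTimes : Opens (ℝ × EuclideanSpace ℝ (Fin 3))) : Set (ℝ × EuclideanSpace ℝ (Fin 3))) volume := by
  rw [Function.uncurry_def]
  refine Integrable.integrableOn ⟨h.aestronglyMeasurable_fderiv_glue, ?_⟩
  rw [hasFiniteIntegral_iff_enorm]
  exact h.lintegral_enorm_fderiv_glue_lt_top

/-- **`|𝔲|² ∈ L¹((0,∞) × ℝ³)`.** [cite: Ozanski2017NSISingular, §2 p. 7] -/
theorem integrable_norm_glue_sq (h : IsNSIBlock T ν₀ τ z G u) :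
    Integrable (fun q : ℝ × EuclideanSpace ℝ (Fin 3) => ‖glue T τ z u q.1 q.2‖ ^ 2)
      (volume.restrict ((positiveTimes : Opens (ℝ × EuclideanSpace ℝ (Fin 3))) :
        Set (ℝ × EuclideanSpace ℝ (Fin 3)))) := by
  have hm : AEStronglyMeasurable (fun q : ℝ × EuclideanSpace ℝ (Fin 3) => ‖glue T τ z u q.1 q.2‖ ^ 2)
      volume := (continuous_norm.pow 2).comp_aestronglyMeasurable h.aestronglyMeasurable_glue
  refine Integrable.restrict ⟨hm, ?_⟩
  rw [hasFiniteIntegral_iff_enorm]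
  have h1 := h.lintegral_enorm_glue_pow_lt_top (by norm_num : 1 ≤ 2) (by norm_num : 2 ≤ 4)
  refine lt_of_le_of_lt (le_of_eq (lintegral_congr fun q => ?_)) h1
  rw [Real.enorm_eq_ofReal (by positivity), ENNReal.ofReal_pow (norm_nonneg _), ofReal_norm]

/-- **`|𝔲|³ ∈ L¹((0,∞) × ℝ³)`** (Scheffer 1985, (2.34)). [cite: Scheffer1985, proof of Lemma 2.3 (2.34)] -/
theorem integrable_norm_glue_cube (h : IsNSIBlock T ν₀ τ z G u) :
    Integrable (fun q : ℝ × EuclideanSpace ℝ (Fin 3) => ‖glue T τ z u q.1 q.2‖ ^ 3)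
      (volume.restrict ((positiveTimes : Opens (ℝ × EuclideanSpace ℝ (Fin 3))) :
        Set (ℝ × EuclideanSpace ℝ (Fin 3)))) := by
  have hm : AEStronglyMeasurable (fun q : ℝ × EuclideanSpace ℝ (Fin 3) => ‖glue T τ z u q.1 q.2‖ ^ 3)
      volume := (continuous_norm.pow 3).comp_aestronglyMeasurable h.aestronglyMeasurable_glue
  refine Integrable.restrict ⟨hm, ?_⟩
  rw [hasFiniteIntegral_iff_enorm]
  have h1 := h.lintegral_enorm_glue_pow_lt_top (by norm_num : 1 ≤ 3) (by norm_num : 3 ≤ 4)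
  refine lt_of_le_of_lt (le_of_eq (lintegral_congr fun q => ?_)) h1
  rw [Real.enorm_eq_ofReal (by positivity), ENNReal.ofReal_pow (norm_nonneg _), ofReal_norm]

/-- **`|p̃[𝔲]||𝔲| ∈ L¹((0,∞) × ℝ³)`** (Scheffer 1985, (1.6)/(2.34)). [cite: Scheffer1985, proof of Lemma 2.3 (2.34)] -/
theorem integrable_pressure_mul_norm_glue (h : IsNSIBlock T ν₀ τ z G u) :
    Integrable (fun q : ℝ × EuclideanSpace ℝ (Fin 3) =>
        |normalisedPressure (glue T τ z u q.1) q.2| * ‖glue T τ z u q.1 q.2‖)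
      (volume.restrict ((positiveTimes : Opens (ℝ × EuclideanSpace ℝ (Fin 3))) :
        Set (ℝ × EuclideanSpace ℝ (Fin 3)))) := by
  have hm : AEStronglyMeasurable (fun q : ℝ × EuclideanSpace ℝ (Fin 3) =>
      |normalisedPressure (glue T τ z u q.1) q.2| * ‖glue T τ z u q.1 q.2‖) volume := by
    exact (h.aestronglyMeasurable_pressure_glue.norm.congr
      (Eventually.of_forall fun q => Real.norm_eq_abs _)).mul h.aestronglyMeasurable_glue.norm
  refine Integrable.restrict ⟨hm, ?_⟩
  rw [hasFiniteIntegral_iff_enorm]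
  refine lt_of_le_of_lt (le_of_eq (lintegral_congr fun q => ?_)) h.lintegral_pressure_mul_norm_glue_lt_top
  rw [enorm_mul, enorm_mul, Real.enorm_abs, enorm_norm]

/-- **`|D𝔲|² ∈ L¹((0,∞) × ℝ³)`** (Ożański 2017, §2: `∇𝔲 ∈ L²(ℝ³ × (0,∞))`).
[cite: Ozanski2017NSISingular, §2 p. 7] -/
theorem integrable_frobeniusNormSq_glue (h : IsNSIBlock T ν₀ τ z G u) :
    Integrable (fun q : ℝ × EuclideanSpace ℝ (Fin 3) => frobeniusNormSq (fderiv ℝ (glue T τ z u q.1) q.2))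
      (volume.restrict ((positiveTimes : Opens (ℝ × EuclideanSpace ℝ (Fin 3))) :
        Set (ℝ × EuclideanSpace ℝ (Fin 3)))) := by
  have hm : AEStronglyMeasurable
      (fun q : ℝ × EuclideanSpace ℝ (Fin 3) => frobeniusNormSq (fderiv ℝ (glue T τ z u q.1) q.2)) volume := by
    exact LerayHopfProofs.continuous_frobeniusNormSq.comp_aestronglyMeasurable h.aestronglyMeasurable_fderiv_glue
  refine Integrable.restrict ⟨hm, ?_⟩
  rw [hasFiniteIntegral_iff_enorm]
  refine lt_of_le_of_lt (le_of_eq (lintegral_congr fun q => ?_)) h.lintegral_frobeniusNormSq_glue_lt_top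
  rw [Real.enorm_eq_ofReal (frobeniusNormSq_nonneg _)]

/-! ### The energy bound -/

/-- A uniform bound for `u` on `[0,T] × ℝ³`. [folklore] -/
theorem exists_bound_norm (h : IsNSIBlock T ν₀ τ z G u) :
    ∃ M : ℝ, 0 ≤ M ∧ ∀ t ∈ Icc 0 T, ∀ x, ‖u t x‖ ≤ M := by
  obtain ⟨M, hM⟩ := (isCompact_Icc.prod h.isCompact).exists_bound_of_continuousOn
    (h.continuousOn_uncurry.mono (prod_mono Subset.rfl (subset_univ _)))
  refine ⟨max M 0, le_max_right _ _, fun t ht x => ?_⟩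
  by_cases hx : x ∈ G
  · exact (hM (t, x) (mk_mem_prod ht hx)).trans (le_max_left _ _)
  · rw [h.apply_eq_zero_of_notMem ht hx, norm_zero]; exact le_max_right _ _

/-- A uniform bound for the energy of the slices `u(t)`, `t ∈ [0,T]`. [folklore] -/
theorem exists_energy_bound (h : IsNSIBlock T ν₀ τ z G u) :
    ∃ C : ℝ≥0∞, C < ⊤ ∧ ∀ t ∈ Icc 0 T, ∫⁻ x, ‖u t x‖ₑ ^ 2 ≤ C := by
  obtain ⟨M, hM0, hM⟩ := h.exists_bound_norm
  refine ⟨ENNReal.ofReal (M ^ 2) * volume G, ENNReal.mul_lt_top ENNReal.ofReal_lt_top h.isCompact.measure_lt_top,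
    fun t ht => ?_⟩
  calc ∫⁻ x, ‖u t x‖ₑ ^ 2 ≤ ∫⁻ x, G.indicator (fun _ => ENNReal.ofReal (M ^ 2)) x := by
        refine lintegral_mono fun x => ?_
        by_cases hx : x ∈ G
        · rw [indicator_of_mem hx, ← ofReal_norm, ← ENNReal.ofReal_pow (norm_nonneg _)]
          exact ENNReal.ofReal_le_ofReal (pow_le_pow_left₀ (norm_nonneg _) (hM t ht x) 2)
        · simp [h.apply_eq_zero_of_notMem ht hx]
    _ = ENNReal.ofReal (M ^ 2) * volume G := lintegral_indicator_const h.isCompact.measurableSet _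

/-- **The energy of the glued field is bounded**: `∫|𝔲(s)|² ≤ sup_{[0,T]} ∫|u|²` for every
`s > 0` (`∫|u^{(j)}(s)|² = τʲ ∫|u(σ)|²`, Ożański 2017, §2: "`‖𝔲(t)‖ ≤ τ^{j/2} sup‖u^{(0)}‖`").
[cite: Ozanski2017NSISingular, §2 p. 7] -/
theorem energy_glue (h : IsNSIBlock T ν₀ τ z G u) :
    ∃ C : ℝ≥0∞, C < ⊤ ∧ ∀ s : ℝ, 0 < s → ∫⁻ x, ‖glue T τ z u s x‖ₑ ^ 2 ≤ C := by
  obtain ⟨C, hC, hE⟩ := h.exists_energy_bound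
  refine ⟨C, hC, fun s hs => ?_⟩
  by_cases hs' : s < blowupTime T τ
  · obtain ⟨j, hj⟩ := exists_mem_Ico_switchTime h.τ_pos h.τ_lt_one hs.le hs'
    have hσ := h.localTime_mem (Ico_subset_Icc_self hj)
    have hα := h.inv_tau_pow_pos j
    rw [glue_eq_piece h.T_pos h.τ_pos z u hj, piece_slice_eq_smul_comp_affine]
    have e : ∀ x : EuclideanSpace ℝ (Fin 3), ‖(τ⁻¹) ^ j •
        u ((τ⁻¹) ^ (2 * j) * (s - switchTime T τ j)) ((1 - (τ⁻¹) ^ j) • (1 - τ)⁻¹ • z + (τ⁻¹) ^ j • x)‖ₑ ^ 2 =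
        ENNReal.ofReal (((τ⁻¹) ^ j) ^ 2) *
          ‖u ((τ⁻¹) ^ (2 * j) * (s - switchTime T τ j)) ((1 - (τ⁻¹) ^ j) • (1 - τ)⁻¹ • z + (τ⁻¹) ^ j • x)‖ₑ ^ 2 := by
      intro x
      simp only [enorm_smul, mul_pow, Real.enorm_eq_ofReal hα.le, ENNReal.ofReal_pow hα.le]
    rw [lintegral_congr e,
      lintegral_comp_space_affine hα ((1 - (τ⁻¹) ^ j) • (1 - τ)⁻¹ • z)
        (fun y => ENNReal.ofReal (((τ⁻¹) ^ j) ^ 2) * ‖u ((τ⁻¹) ^ (2 * j) * (s - switchTime T τ j)) y‖ₑ ^ 2),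
      lintegral_const_mul' _ _ ENNReal.ofReal_ne_top,
      ← mul_assoc, ← ENNReal.ofReal_mul (by positivity), finrank_euclideanSpace_fin]
    have hcoef : (((τ⁻¹) ^ j) ^ 3)⁻¹ * ((τ⁻¹) ^ j) ^ 2 = τ ^ j := by
      rw [inv_pow, inv_pow, inv_inv, inv_pow]
      field_simp
    rw [hcoef]
    have hσ' : (τ⁻¹) ^ (2 * j) * (s - switchTime T τ j) ∈ Icc 0 T := by
      convert hσ using 1; ring
    calc ENNReal.ofReal (τ ^ j) * ∫⁻ y, ‖u ((τ⁻¹) ^ (2 * j) * (s - switchTime T τ j)) y‖ₑ ^ 2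
        ≤ 1 * ∫⁻ y, ‖u ((τ⁻¹) ^ (2 * j) * (s - switchTime T τ j)) y‖ₑ ^ 2 := by
          gcongr
          exact ENNReal.ofReal_le_one.2 (pow_le_one₀ h.τ_pos.le h.τ_lt_one.le)
      _ ≤ C := by rw [one_mul]; exact hE _ hσ'
  · rw [glue_eq_zero_of_le h.T_pos h.τ_pos h.τ_lt_one z u (not_lt.1 hs')]
    simp

end IsNSIBlock

end Literature.Barriers.NavierStokesRegularity

end
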